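import Mathlib

/-!
# The structure dichotomy (S) of THEOREM F′ for S3, reduced to five typed pieces
# (crux `LevelGradedCohnUmans.GradedDesignFamily`, stmt-MatrixMultiplication-7610; negative side,
# line `quadratic-extension-level-one-cell`, unit b2b-lgcu-subfield gen 18)

HONEST FRAMING.  `footprintExpansion_of_structure` (`Negative/SubfieldCellExpansion.lean`) derives
FOOTPRINT EXPANSION (hence `¬S3`, `Negative/SubfieldCellFootprint.lean`) from (T), (S), (E1), (E2);
(E1) and (E2) are proved (`subfieldCell_slicedEndgame`, `subfieldCell_borelEndgame`).  This file is
the kernel-checked COMPOSITION of hypothesis (S) — "an `M`-approximate subgroup `𝓐 ⊆ GL₂(K)` with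
`c₁|K|³ ≤ |𝓐| ≤ c₂|K|³` has `≤ m₀` determinant values or fixes a line" — from five smaller statements,
each spelled out inline as a hypothesis (no definitions), so that each is a separate target:
* (P1) determinant pigeonhole: `|𝓐| ≤ (|K| − 1)·|𝓐² ∩ SL₂|` for symmetric `𝓐` [elementary];
* (BGT) Breuillard–Green–Tao 2011, Thm 1.3 for `SL₂` in the embedded form: a `K₀`-approximate subgroup
  of `GL₂(K)` consisting of determinant-one matrices and generating `ker det = SL₂(K)` has `≤ C(K₀)`
  elements or at least `|SL₂(K)|/C(K₀)` [external theorem, cite item wi-56684];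
* (Dickson) a proper subgroup of `SL₂(K)` with `≥ β|K|²` elements fixes a line once `|K| ≥ Q₅(β)`
  [Dickson's classification, cite item wi-56685];
* (P4) sliced counting: if `|𝓐⁴ ∩ SL₂| ≥ |SL₂(K)|/C` then `𝓐` has `≤ m₀(M, c₂, C)` determinant values
  [elementary: disjoint translates inside `𝓐⁵`, `|𝓐⁵| ≤ M⁴|𝓐|`];
* (P5) Borel propagation: if `⟨𝓐⁴ ∩ SL₂⟩` fixes the line `Kv` and `|𝓐² ∩ SL₂| ≥ c₁|K|² > |K| − 1`
  then every element of `𝓐` fixes `Kv` [elementary: a unipotent of `⟨𝓐² ∩ SL₂⟩` conjugated by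
  `h ∈ 𝓐` stays in `⟨𝓐⁴ ∩ SL₂⟩`, and a non-trivial unipotent fixes exactly one line].
The only Mathlib input used here is `IsApproximateSubgroup.pow_inter_pow` (`𝓐⁴ ∩ SL₂` is an
`M⁷`-approximate subgroup).  The conclusion is hypothesis (S) of `footprintExpansion_of_structure`
VERBATIM.  A reduction on the NEGATIVE side of the design stub S3; NOT summit progress.

Sorry-free. [folklore]
-/

set_option linter.dupNamespace false

open scoped Pointwise

namespace Summit.MatrixMultiplication.MatrixMultiplication.Theorems.GradedDesignFamily.Negative

/-- **(S) from five pieces.**  See the module docstring; the conclusion is hypothesis (S) of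
`footprintExpansion_of_structure` verbatim.  NOT summit progress. [folklore] -/
theorem structureDichotomy_of_pieces
    (hP1 : ∀ (K : Type) [Field K] [Fintype K] [DecidableEq K]
      (A : Finset (Matrix.GeneralLinearGroup (Fin 2) K)), A.Nonempty →
      (↑A : Set (Matrix.GeneralLinearGroup (Fin 2) K))⁻¹ = ↑A →
      A.card ≤ (Fintype.card K - 1) *
        ((A ^ 2).filter fun g => Matrix.GeneralLinearGroup.det g = 1).card)
    (hBGT : ∃ C : ℝ → ℝ, ∀ K₀ : ℝ, 1 ≤ C K₀ ∧
      ∀ (K : Type) [Field K] [Fintype K] [DecidableEq K]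
        (B : Finset (Matrix.GeneralLinearGroup (Fin 2) K)),
        (∀ b ∈ B, Matrix.GeneralLinearGroup.det b = 1) →
        IsApproximateSubgroup K₀ (B : Set (Matrix.GeneralLinearGroup (Fin 2) K)) →
        Subgroup.closure (B : Set (Matrix.GeneralLinearGroup (Fin 2) K)) =
          (Matrix.GeneralLinearGroup.det : Matrix.GeneralLinearGroup (Fin 2) K →* Kˣ).ker →
        (B.card : ℝ) ≤ C K₀ ∨
          (Nat.card (Matrix.GeneralLinearGroup.det :
              Matrix.GeneralLinearGroup (Fin 2) K →* Kˣ).ker : ℝ) ≤ C K₀ * B.card)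
    (hDickson : ∀ β : ℝ, 0 < β → ∃ Q₅ : ℕ, ∀ (K : Type) [Field K] [Fintype K] [DecidableEq K],
      Q₅ ≤ Fintype.card K → ∀ L : Subgroup (Matrix.GeneralLinearGroup (Fin 2) K),
        L ≤ (Matrix.GeneralLinearGroup.det : Matrix.GeneralLinearGroup (Fin 2) K →* Kˣ).ker →
        L ≠ (Matrix.GeneralLinearGroup.det : Matrix.GeneralLinearGroup (Fin 2) K →* Kˣ).ker →
        (∃ B : Finset (Matrix.GeneralLinearGroup (Fin 2) K),
          (↑B : Set (Matrix.GeneralLinearGroup (Fin 2) K)) ⊆ L ∧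
            β * (Fintype.card K : ℝ) ^ 2 ≤ B.card) →
        ∃ v : Fin 2 → K, v ≠ 0 ∧ ∀ g ∈ L, ∃ t : K,
          (g : Matrix (Fin 2) (Fin 2) K).mulVec v = t • v)
    (hP4 : ∀ M c₂ C : ℝ, 1 ≤ M → 0 < c₂ → 0 < C → ∃ m₀ Q₆ : ℕ,
      ∀ (K : Type) [Field K] [Fintype K] [DecidableEq K], Q₆ ≤ Fintype.card K →
        ∀ A : Finset (Matrix.GeneralLinearGroup (Fin 2) K),
          IsApproximateSubgroup M (A : Set (Matrix.GeneralLinearGroup (Fin 2) K)) →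
          (A.card : ℝ) ≤ c₂ * (Fintype.card K : ℝ) ^ 3 →
          (Nat.card (Matrix.GeneralLinearGroup.det :
              Matrix.GeneralLinearGroup (Fin 2) K →* Kˣ).ker : ℝ) ≤
            C * ((A ^ 4).filter fun g => Matrix.GeneralLinearGroup.det g = 1).card →
          (A.image Matrix.GeneralLinearGroup.det).card ≤ m₀)
    (hP5 : ∀ c₁ : ℝ, 0 < c₁ → ∃ Q₇ : ℕ, ∀ (K : Type) [Field K] [Fintype K] [DecidableEq K],
      Q₇ ≤ Fintype.card K → ∀ A : Finset (Matrix.GeneralLinearGroup (Fin 2) K), 1 ∈ A →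
        (↑A : Set (Matrix.GeneralLinearGroup (Fin 2) K))⁻¹ = ↑A →
        c₁ * (Fintype.card K : ℝ) ^ 2 ≤
          ((A ^ 2).filter fun g => Matrix.GeneralLinearGroup.det g = 1).card →
        ∀ v : Fin 2 → K, v ≠ 0 →
          (∀ g ∈ Subgroup.closure
              (↑((A ^ 4).filter fun g => Matrix.GeneralLinearGroup.det g = 1) :
                Set (Matrix.GeneralLinearGroup (Fin 2) K)),
            ∃ t : K, (g : Matrix (Fin 2) (Fin 2) K).mulVec v = t • v) →
          ∀ a ∈ A, ∃ t : K, (a : Matrix (Fin 2) (Fin 2) K).mulVec v = t • v) :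
    ∀ M c₁ c₂ : ℝ, 1 ≤ M → 0 < c₁ → 0 < c₂ → ∃ m₀ Q₂ : ℕ,
      ∀ (K : Type) [Field K] [Fintype K] [DecidableEq K], Q₂ ≤ Fintype.card K →
        ∀ A : Finset (Matrix.GeneralLinearGroup (Fin 2) K),
          IsApproximateSubgroup M (A : Set (Matrix.GeneralLinearGroup (Fin 2) K)) →
          c₁ * (Fintype.card K : ℝ) ^ 3 ≤ A.card → (A.card : ℝ) ≤ c₂ * (Fintype.card K : ℝ) ^ 3 →
          (A.image Matrix.GeneralLinearGroup.det).card ≤ m₀ ∨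
            ∃ v : Fin 2 → K, v ≠ 0 ∧ ∀ a ∈ A, ∃ t : K,
              (a : Matrix (Fin 2) (Fin 2) K).mulVec v = t • v := by
  intro M c₁ c₂ hM hc₁ hc₂
  obtain ⟨C, hC⟩ := hBGT
  obtain ⟨hC1, hC'⟩ := hC (M ^ 7)
  have hCpos : 0 < C (M ^ 7) := by linarith
  obtain ⟨m₀, Q₆, h4⟩ := hP4 M c₂ (C (M ^ 7)) hM hc₂ hCpos
  obtain ⟨Q₅, h3⟩ := hDickson c₁ hc₁
  obtain ⟨Q₇, h5⟩ := hP5 c₁ hc₁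
  refine ⟨m₀, max (max Q₅ Q₆) (max Q₇ (⌈C (M ^ 7) / c₁⌉₊ + 2)), ?_⟩
  intro K _ _ _ hQ A happ hlo hhi
  have hQ5 : Q₅ ≤ Fintype.card K := le_trans (le_trans (le_max_left _ _) (le_max_left _ _)) hQ
  have hQ6 : Q₆ ≤ Fintype.card K := le_trans (le_trans (le_max_right _ _) (le_max_left _ _)) hQ
  have hQ7 : Q₇ ≤ Fintype.card K := le_trans (le_trans (le_max_left _ _) (le_max_right _ _)) hQ
  have hQ8 : ⌈C (M ^ 7) / c₁⌉₊ + 2 ≤ Fintype.card K :=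
    le_trans (le_trans (le_max_right _ _) (le_max_right _ _)) hQ
  have hQR : (⌈C (M ^ 7) / c₁⌉₊ : ℝ) + 2 ≤ (Fintype.card K : ℝ) := by exact_mod_cast hQ8
  have hceil := Nat.le_ceil (C (M ^ 7) / c₁)
  have hceil0 : (0 : ℝ) ≤ (⌈C (M ^ 7) / c₁⌉₊ : ℝ) := Nat.cast_nonneg _
  have hQ1 : (1 : ℝ) ≤ (Fintype.card K : ℝ) := by linarith
  have hQpos : (0 : ℝ) < (Fintype.card K : ℝ) := by linarith
  -- `A` is symmetric and contains `1`
  have hsymm : (↑A : Set (Matrix.GeneralLinearGroup (Fin 2) K))⁻¹ = ↑A := happ.inv_eq_self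
  have h1 : (1 : Matrix.GeneralLinearGroup (Fin 2) K) ∈ A := Finset.mem_coe.1 happ.one_mem
  have hne : A.Nonempty := ⟨1, h1⟩
  -- `A² ∩ SL₂` is large
  have hA2 : c₁ * (Fintype.card K : ℝ) ^ 2 ≤
      (((A ^ 2).filter fun g => Matrix.GeneralLinearGroup.det g = 1).card : ℝ) := by
    have hP := hP1 K A hne hsymm
    have hP' : A.card ≤ Fintype.card K *
        ((A ^ 2).filter fun g => Matrix.GeneralLinearGroup.det g = 1).card :=
      hP.trans (Nat.mul_le_mul_right _ (Nat.sub_le _ _))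
    have hP'' : (A.card : ℝ) ≤ (Fintype.card K : ℝ) *
        ((A ^ 2).filter fun g => Matrix.GeneralLinearGroup.det g = 1).card := by
      exact_mod_cast hP'
    by_contra hlt
    rw [not_le] at hlt
    have := mul_lt_mul_of_pos_left hlt hQpos
    nlinarith
  -- `A² ∩ SL₂ ⊆ A⁴ ∩ SL₂`
  have h24 : ((A ^ 2).filter fun g => Matrix.GeneralLinearGroup.det g = 1) ⊆
      ((A ^ 4).filter fun g => Matrix.GeneralLinearGroup.det g = 1) :=
    Finset.filter_subset_filter _ (Finset.pow_subset_pow_right h1 (by norm_num))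
  have hA4 : c₁ * (Fintype.card K : ℝ) ^ 2 ≤
      (((A ^ 4).filter fun g => Matrix.GeneralLinearGroup.det g = 1).card : ℝ) :=
    hA2.trans (by exact_mod_cast Finset.card_le_card h24)
  -- `A⁴ ∩ SL₂` is an `M⁷`-approximate subgroup (Mathlib `IsApproximateSubgroup.pow_inter_pow`)
  have happ4 : IsApproximateSubgroup (M ^ 7)
      (↑((A ^ 4).filter fun g => Matrix.GeneralLinearGroup.det g = 1) :
        Set (Matrix.GeneralLinearGroup (Fin 2) K)) := by
    have hker : IsApproximateSubgroup 1
        (((Matrix.GeneralLinearGroup.det : Matrix.GeneralLinearGroup (Fin 2) K →* Kˣ).ker :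
          Subgroup (Matrix.GeneralLinearGroup (Fin 2) K)) :
          Set (Matrix.GeneralLinearGroup (Fin 2) K)) := IsApproximateSubgroup.subgroup
    have h := happ.pow_inter_pow hker (show 2 ≤ 4 by norm_num) (le_refl 2)
    have hk2 : (((Matrix.GeneralLinearGroup.det : Matrix.GeneralLinearGroup (Fin 2) K →* Kˣ).ker :
          Subgroup (Matrix.GeneralLinearGroup (Fin 2) K)) :
          Set (Matrix.GeneralLinearGroup (Fin 2) K)) ^ 2 =
        ((Matrix.GeneralLinearGroup.det : Matrix.GeneralLinearGroup (Fin 2) K →* Kˣ).ker :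
          Subgroup (Matrix.GeneralLinearGroup (Fin 2) K)) := by
      ext x
      rw [sq, Set.mem_mul]
      constructor
      · rintro ⟨a, ha, b, hb, rfl⟩
        exact mul_mem ha hb
      · intro hx
        exact ⟨x, hx, 1, one_mem _, mul_one x⟩
    have hset : (↑((A ^ 4).filter fun g => Matrix.GeneralLinearGroup.det g = 1) :
        Set (Matrix.GeneralLinearGroup (Fin 2) K)) =
        (↑A : Set (Matrix.GeneralLinearGroup (Fin 2) K)) ^ 4 ∩
          (((Matrix.GeneralLinearGroup.det : Matrix.GeneralLinearGroup (Fin 2) K →* Kˣ).ker :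
            Subgroup (Matrix.GeneralLinearGroup (Fin 2) K)) :
            Set (Matrix.GeneralLinearGroup (Fin 2) K)) ^ 2 := by
      rw [hk2, Finset.coe_filter]
      ext x
      simp only [Set.mem_setOf_eq, Set.mem_inter_iff, SetLike.mem_coe, MonoidHom.mem_ker,
        ← Finset.coe_pow]
    rw [hset]
    exact h.mono (le_of_eq (by norm_num))
  -- the generated subgroup lies in `SL₂ = ker det`
  have hdet4 : ∀ g ∈ ((A ^ 4).filter fun g => Matrix.GeneralLinearGroup.det g = 1),
      Matrix.GeneralLinearGroup.det g = 1 := fun g hg => (Finset.mem_filter.1 hg).2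
  have hL4 : Subgroup.closure (↑((A ^ 4).filter fun g => Matrix.GeneralLinearGroup.det g = 1) :
        Set (Matrix.GeneralLinearGroup (Fin 2) K)) ≤
      (Matrix.GeneralLinearGroup.det : Matrix.GeneralLinearGroup (Fin 2) K →* Kˣ).ker := by
    rw [Subgroup.closure_le]
    intro g hg
    rw [SetLike.mem_coe, MonoidHom.mem_ker]
    exact hdet4 g (Finset.mem_coe.1 hg)
  by_cases hgen : Subgroup.closure (↑((A ^ 4).filter fun g => Matrix.GeneralLinearGroup.det g = 1) :
        Set (Matrix.GeneralLinearGroup (Fin 2) K)) =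
      (Matrix.GeneralLinearGroup.det : Matrix.GeneralLinearGroup (Fin 2) K →* Kˣ).ker
  · -- generation: BGT, then sliced counting
    rcases hC' K _ hdet4 happ4 hgen with hsmall | hlarge
    · exfalso
      have hdiv : C (M ^ 7) = c₁ * (C (M ^ 7) / c₁) := by field_simp
      have hCQ : C (M ^ 7) < c₁ * (Fintype.card K : ℝ) := by
        have h1' : C (M ^ 7) / c₁ + 2 ≤ (Fintype.card K : ℝ) := by linarith
        nlinarith [h1', hc₁]
      have : c₁ * (Fintype.card K : ℝ) ≤ c₁ * (Fintype.card K : ℝ) ^ 2 := by nlinarith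
      linarith [hA4, hsmall]
    · exact Or.inl (h4 K hQ6 A happ hhi hlarge)
  · -- a proper subgroup: Dickson, then Borel propagation
    obtain ⟨v, hv, hLv⟩ := h3 K hQ5 _ hL4 hgen ⟨_, Subgroup.subset_closure, hA4⟩
    exact Or.inr ⟨v, hv, h5 K hQ7 A h1 hsymm hA2 v hv hLv⟩

end Summit.MatrixMultiplication.MatrixMultiplication.Theorems.GradedDesignFamily.Negative
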